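import Mathlib
import Summits.ValiantsHypothesis.ValiantsHypothesis.Theorems.NewtonUnitEquationsDissociatedUniformQuasiPoly
import Summits.ValiantsHypothesis.ValiantsHypothesis.Theorems.NewtonUnitEquationsNewtonTauWeakRefineDissociate

/-!
# Crux `NewtonUnitEquations.DissociatedUniform` (stmt-ValiantsHypothesis-5905), line `greedy-basis-shadow`:
# the frame shadow is EXACTLY the set of words exposed as Newton-polygon vertices along the coefficient pencil

Dictionary for the kernel stub `stub_smallShadow` (skeleton v5, `Cruxes/DissociatedUniform/Lines/greedy_basis_shadow.lean`).

* `QuasiPoly.mem_gE_iff_exists_functional`: a word `e ∈ E` is lex-greedy for the height `h`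
  (`x e ∉ span {x e' : h e < h e'}`) iff some linear functional `y ↦ ∑ i, φ i * y i` on `ℂ^k` kills the vectors of all
  strictly higher words but not `x e` — i.e. iff `e` is the `h`-TOP element of the support of the tensor
  `b ↦ ∑ i, φ i * x b i`, a member of the span of the `k` rank-one coefficient tensors.
* `ShadowVertices.coeff_pencil`: on a dissociated frame the coefficient of the pencil member
  `F_φ = ∑ i, C (φ i) * ∏ j, f i j` at the point `∑ j, a j` of a word `a` is `∑ i, φ i * col f a i`.
* `ShadowVertices.fshadow_eq_pencilVertexWords`: on a dissociated frame (`supp (f i j) ⊆ A j`, sum map injective on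
  the box) the frame shadow `QuasiPoly.fshadow A f` (Theorem Q) is EXACTLY the set of words `a` of the box whose point
  is a vertex of the Newton polygon of SOME pencil member `F_φ`, `φ : Fin k → ℂ`.
* `ShadowVertices.smallShadow_iff_pencilVertices`: hence the registered kernel stub `stub_smallShadow` (verbatim its
  signature, hypothesis-free) is EQUIVALENT to the crux's own vertex count made UNIFORM OVER THE PENCIL on small
  frames: "on every dissociated `k`-product frame with `n ≤ 4k²` coordinates and `≤ 4k² + 1` letters per coordinate,
  the words exposed as a vertex of `Newt(∑ i, φ i ∏ j, f i j)` for some `φ ∈ ℂ^k` number at most `(k+2)^P`"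
  (the shadow is empty on non-dissociated frames and only sees the coefficients on the alphabet,
  `fshadow_eq_empty_of_not_dissociated`, `fshadow_restrict`).
So `SmallShadow` sits between the crux on `O(k²)`-size frames (one `φ`) and a pencil-uniform version of it; on the
abelian-design stratum the two coincide (every class is itself a pencil member).  [folklore: greedy bases of a
vector configuration / exposed points]
-/

set_option linter.dupNamespace false

open scoped BigOperators
open MvPolynomial

namespace Summit.ValiantsHypothesis.ValiantsHypothesis.Theorems.NewtonUnitEquationsDissociatedUniform

namespace QuasiPoly

variable {α : Type} {k : ℕ}

/-- The coordinate functional `y ↦ ∑ i, φ i * y i` on `Fin k → ℂ` as a linear map. [folklore] -/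
theorem exists_linearMap_eq_sum (φ : Fin k → ℂ) :
    ∃ L : (Fin k → ℂ) →ₗ[ℂ] ℂ, ∀ y, L y = ∑ i, φ i * y i := by
  refine ⟨∑ i : Fin k, φ i • (LinearMap.proj i : (Fin k → ℂ) →ₗ[ℂ] ℂ), fun y => ?_⟩
  rw [LinearMap.sum_apply]
  refine Finset.sum_congr rfl fun i _ => ?_
  simp only [LinearMap.smul_apply, LinearMap.proj_apply, smul_eq_mul]

/-- **Greedy words are top words of tensor supports.**  `e` is lex-greedy for `h` iff a coordinate functional
`y ↦ ∑ i, φ i * y i` kills the vectors of all strictly higher words of `E` but not `x e`. [folklore] -/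
theorem mem_gE_iff_exists_functional (E : Finset α) (x : α → Fin k → ℂ) (h : α → ℝ) (e : α) :
    e ∈ gE E x h ↔ e ∈ E ∧ ∃ φ : Fin k → ℂ, (∑ i, φ i * x e i) ≠ 0 ∧
      ∀ e' ∈ E, h e < h e' → ∑ i, φ i * x e' i = 0 := by
  classical
  constructor
  · rintro ⟨heE, hnot⟩
    refine ⟨heE, ?_⟩
    obtain ⟨L, hLe, hLspan⟩ := Submodule.exists_dual_map_eq_bot_of_notMem hnot inferInstance
    refine ⟨fun i => L (fun j => if i = j then 1 else 0), ?_, ?_⟩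
    · have hsum : ∑ i, L (fun j => if i = j then (1 : ℂ) else 0) * x e i = L (x e) := by
        rw [LinearMap.pi_apply_eq_sum_univ L (x e)]
        refine Finset.sum_congr rfl fun i _ => ?_
        rw [smul_eq_mul, mul_comm]
      rw [hsum]; exact hLe
    · intro e' he'E hlt
      have hsum : ∑ i, L (fun j => if i = j then (1 : ℂ) else 0) * x e' i = L (x e') := by
        rw [LinearMap.pi_apply_eq_sum_univ L (x e')]
        refine Finset.sum_congr rfl fun i _ => ?_
        rw [smul_eq_mul, mul_comm]
      rw [hsum]
      have hmem : x e' ∈ Submodule.span ℂ (x '' {e'' : α | e'' ∈ E ∧ h e < h e''}) :=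
        Submodule.subset_span ⟨e', ⟨he'E, hlt⟩, rfl⟩
      have : L (x e') ∈ (Submodule.span ℂ (x '' {e'' : α | e'' ∈ E ∧ h e < h e''})).map L :=
        Submodule.mem_map_of_mem hmem
      rw [hLspan] at this
      exact (Submodule.mem_bot ℂ).mp this
  · rintro ⟨heE, φ, hne, hzero⟩
    refine ⟨heE, ?_⟩
    obtain ⟨L, hL⟩ := exists_linearMap_eq_sum φ
    refine TopSurvivorGreedy.not_mem_span_of_functional L ?_ ?_
    · rintro _ ⟨e', ⟨he'E, hlt⟩, rfl⟩
      rw [hL]; exact hzero e' he'E hlt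
    · rw [hL]; exact hne

/-- The configuration shadow in functional form. [folklore] -/
theorem mem_cshadow_iff_exists_functional (E : Finset α) (x : α → Fin k → ℂ) (X Y : α → ℝ) (e : α) :
    e ∈ cshadow E x X Y ↔ ∃ w : Fin 2 → ℝ, Set.InjOn (lin X Y w) E ∧ e ∈ E ∧
      ∃ φ : Fin k → ℂ, (∑ i, φ i * x e i) ≠ 0 ∧ ∀ e' ∈ E, lin X Y w e < lin X Y w e' → ∑ i, φ i * x e' i = 0 := by
  constructor
  · rintro ⟨w, hinj, he⟩
    exact ⟨w, hinj, (mem_gE_iff_exists_functional E x _ e).mp he⟩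
  · rintro ⟨w, hinj, he⟩
    exact ⟨w, hinj, (mem_gE_iff_exists_functional E x _ e).mpr he⟩

/-- Greedy sets only see the vectors on `E`. [folklore] -/
theorem gE_congr_vec (E : Finset α) {x x' : α → Fin k → ℂ} (h : α → ℝ) (hx : ∀ e ∈ E, x e = x' e) :
    gE E x h = gE E x' h := by
  ext e
  simp only [gE, Set.mem_setOf_eq]
  constructor
  · rintro ⟨heE, hn⟩
    refine ⟨heE, fun hm => hn ?_⟩
    rw [hx e heE]
    have : x '' {e' : α | e' ∈ E ∧ h e < h e'} = x' '' {e' : α | e' ∈ E ∧ h e < h e'} := by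
      ext y; constructor
      · rintro ⟨e', he', rfl⟩; exact ⟨e', he', (hx e' he'.1).symm⟩
      · rintro ⟨e', he', rfl⟩; exact ⟨e', he', hx e' he'.1⟩
    rw [this]; exact hm
  · rintro ⟨heE, hn⟩
    refine ⟨heE, fun hm => hn ?_⟩
    rw [← hx e heE]
    have : x '' {e' : α | e' ∈ E ∧ h e < h e'} = x' '' {e' : α | e' ∈ E ∧ h e < h e'} := by
      ext y; constructor
      · rintro ⟨e', he', rfl⟩; exact ⟨e', he', (hx e' he'.1).symm⟩
      · rintro ⟨e', he', rfl⟩; exact ⟨e', he', hx e' he'.1⟩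
    rw [← this]; exact hm

/-- Configuration shadows only see the vectors on `E`. [folklore] -/
theorem cshadow_congr_vec (E : Finset α) {x x' : α → Fin k → ℂ} (X Y : α → ℝ) (hx : ∀ e ∈ E, x e = x' e) :
    cshadow E x X Y = cshadow E x' X Y := by
  ext e
  simp only [cshadow, Set.mem_setOf_eq]
  constructor
  · rintro ⟨w, hinj, he⟩; exact ⟨w, hinj, by rw [← gE_congr_vec E _ hx]; exact he⟩
  · rintro ⟨w, hinj, he⟩; exact ⟨w, hinj, by rw [gE_congr_vec E _ hx]; exact he⟩

end QuasiPoly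

/-! ## Frames: the shadow is the set of pencil-vertex words -/

namespace ShadowVertices

open QuasiPoly
open Summit.ValiantsHypothesis.Theorems.DissociatedFixedK (coeff_sum_prod_of_dissociated)
open Summit.ValiantsHypothesis.ValiantsHypothesis.Theorems.NewtonUnitEquationsNewtonTauWeak (RefineDissociateAux.emb_mem_extremePoints_of_strict)

variable {k m : ℕ}

/-- The planar height `lin Xf Yf w` of a word is the `w`-height of its point. -/
theorem lin_Xf_Yf_eq (w : Fin 2 → ℝ) (a : Fin m → (Fin 2 →₀ ℕ)) :
    lin Xf Yf w a = ∑ i, w i * ((((∑ j, a j) i : ℕ)) : ℝ) := by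
  simp only [lin, Xf, Yf, Fin.sum_univ_two]

/-- **Coefficient formula along the pencil.**  On a dissociated frame the coefficient of
`F_φ = ∑ i, C (φ i) * ∏ j, f i j` at the point of a word `a` of the box is `∑ i, φ i * col f a i`. [folklore] -/
theorem coeff_pencil (A : Fin m → Finset (Fin 2 →₀ ℕ)) (f : Fin k → Fin m → MvPolynomial (Fin 2) ℂ)
    (hsupp : ∀ i j, (f i j).support ⊆ A j)
    (hdis : ∀ a b : Fin m → (Fin 2 →₀ ℕ), (∀ j, a j ∈ A j) → (∀ j, b j ∈ A j) → ∑ j, a j = ∑ j, b j → a = b)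
    (φ : Fin k → ℂ) (a : Fin m → (Fin 2 →₀ ℕ)) (ha : ∀ j, a j ∈ A j) :
    coeff (∑ j, a j) (∑ i, C (φ i) * ∏ j, f i j) = ∑ i, φ i * col f a i := by
  classical
  rw [coeff_sum]
  refine Finset.sum_congr rfl fun i _ => ?_
  rw [coeff_C_mul]
  congr 1
  -- the single product: the dissociated coefficient formula with one product
  have h := coeff_sum_prod_of_dissociated A (fun (_ : Fin 1) j => f i j) (fun _ j => hsupp i j) hdis a ha
  simp only [Finset.univ_unique, Finset.sum_singleton] at h
  rw [h]; rfl

/-- The support of a pencil member lies in the image of the box under the sum map. [folklore] -/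
theorem support_pencil_subset (A : Fin m → Finset (Fin 2 →₀ ℕ)) (f : Fin k → Fin m → MvPolynomial (Fin 2) ℂ)
    (hsupp : ∀ i j, (f i j).support ⊆ A j) (φ : Fin k → ℂ) :
    (∑ i, C (φ i) * ∏ j, f i j).support ⊆ (Fintype.piFinset A).image (fun g => ∑ j, g j) := by
  classical
  refine (support_sum).trans (Finset.biUnion_subset.mpr fun i _ => ?_)
  refine (Finset.Subset.trans ?_ (TopSurvivorGreedy.support_sum_prod_subset_image A
    (fun (_ : Fin 1) j => f i j) (fun _ j => hsupp i j)))
  simp only [Finset.univ_unique, Finset.sum_singleton]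
  rw [C_mul']
  exact support_smul

/-- **Shadow words are pencil-vertex words.**  On a dissociated frame, the point of every word of the frame shadow
is a vertex of the Newton polygon of some pencil member `F_φ = ∑ i, C (φ i) * ∏ j, f i j`. [folklore] -/
theorem exists_vertex_of_mem_fshadow (A : Fin m → Finset (Fin 2 →₀ ℕ))
    (f : Fin k → Fin m → MvPolynomial (Fin 2) ℂ) (hsupp : ∀ i j, (f i j).support ⊆ A j)
    (hdis : ∀ a b : Fin m → (Fin 2 →₀ ℕ), (∀ j, a j ∈ A j) → (∀ j, b j ∈ A j) → ∑ j, a j = ∑ j, b j → a = b)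
    {a : Fin m → (Fin 2 →₀ ℕ)} (ha : a ∈ fshadow A f) :
    ∃ φ : Fin k → ℂ, (fun e : Fin 2 →₀ ℕ => fun i : Fin 2 => ((e i : ℕ) : ℝ)) (∑ j, a j) ∈
      Set.extremePoints ℝ (convexHull ℝ ((fun e : Fin 2 →₀ ℕ => fun i : Fin 2 => ((e i : ℕ) : ℝ)) ''
        ((∑ i, C (φ i) * ∏ j, f i j).support : Set (Fin 2 →₀ ℕ)))) := by
  classical
  obtain ⟨w, hinj, haE, φ, hne, hzero⟩ := (mem_cshadow_iff_exists_functional _ _ _ _ a).mp ha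
  have haA : ∀ j, a j ∈ A j := Fintype.mem_piFinset.mp haE
  refine ⟨φ, RefineDissociateAux.emb_mem_extremePoints_of_strict _ ?_ w ?_⟩
  · rw [mem_support_iff, coeff_pencil A f hsupp hdis φ a haA]
    exact hne
  · intro s hs hsa
    obtain ⟨b, hbE, rfl⟩ := Finset.mem_image.mp (support_pencil_subset A f hsupp φ hs)
    have hbA : ∀ j, b j ∈ A j := Fintype.mem_piFinset.mp hbE
    have hba : b ≠ a := fun h => hsa (by rw [h])
    -- heights of distinct words differ (injective chart); the higher one would have zero coefficient
    have hne' : lin Xf Yf w b ≠ lin Xf Yf w a := fun h =>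
      hba (hinj (Finset.mem_coe.mpr hbE) (Finset.mem_coe.mpr haE) h)
    rcases lt_or_gt_of_ne hne' with hlt | hgt
    · rw [lin_Xf_Yf_eq, lin_Xf_Yf_eq] at hlt
      exact hlt
    · exfalso
      have h0 := hzero b hbE hgt
      rw [← coeff_pencil A f hsupp hdis φ b hbA] at h0
      exact (mem_support_iff.mp hs) h0

/-- **Pencil vertices are shadow points.**  On a dissociated frame, every vertex of the Newton polygon of a pencil
member `F_φ` is the point of a word of the frame shadow. [folklore] -/
theorem exists_mem_fshadow_of_vertex (A : Fin m → Finset (Fin 2 →₀ ℕ))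
    (f : Fin k → Fin m → MvPolynomial (Fin 2) ℂ) (hsupp : ∀ i j, (f i j).support ⊆ A j)
    (hdis : ∀ a b : Fin m → (Fin 2 →₀ ℕ), (∀ j, a j ∈ A j) → (∀ j, b j ∈ A j) → ∑ j, a j = ∑ j, b j → a = b)
    (φ : Fin k → ℂ) {v : Fin 2 → ℝ}
    (hv : v ∈ Set.extremePoints ℝ (convexHull ℝ ((fun e : Fin 2 →₀ ℕ => fun i : Fin 2 => ((e i : ℕ) : ℝ)) ''
        ((∑ i, C (φ i) * ∏ j, f i j).support : Set (Fin 2 →₀ ℕ))))) :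
    ∃ a ∈ fshadow A f, (fun i : Fin 2 => ((((∑ j, a j) i : ℕ)) : ℝ)) = v := by
  classical
  obtain ⟨w, e₀, he₀, hVe, hmax, hinjT⟩ := stub_exposedGenericDirection _
    ((Fintype.piFinset A).image fun a => ∑ j, a j) v hv
  have he₀' : e₀ ∈ (Fintype.piFinset A).image (fun g => ∑ j, g j) := support_pencil_subset A f hsupp φ he₀
  obtain ⟨a₀, ha₀E, ha₀e⟩ := Finset.mem_image.mp he₀'
  have ha₀A : ∀ j, a₀ j ∈ A j := Fintype.mem_piFinset.mp ha₀E
  refine ⟨a₀, ?_, by rw [ha₀e]; exact hVe⟩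
  refine (mem_cshadow_iff_exists_functional _ _ _ _ a₀).mpr ⟨w, ?_, ha₀E, φ, ?_, ?_⟩
  · -- injectivity on the box from injectivity on the points and dissociation
    intro a ha b hb hab
    have ha' := Fintype.mem_piFinset.mp (Finset.mem_coe.mp ha)
    have hb' := Fintype.mem_piFinset.mp (Finset.mem_coe.mp hb)
    rw [lin_Xf_Yf_eq, lin_Xf_Yf_eq] at hab
    have hTa : (∑ j, a j) ∈ (((Fintype.piFinset A).image fun a => ∑ j, a j : Finset _) : Set (Fin 2 →₀ ℕ)) :=
      Finset.mem_coe.mpr (Finset.mem_image.mpr ⟨a, Finset.mem_coe.mp ha, rfl⟩)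
    have hTb : (∑ j, b j) ∈ (((Fintype.piFinset A).image fun a => ∑ j, a j : Finset _) : Set (Fin 2 →₀ ℕ)) :=
      Finset.mem_coe.mpr (Finset.mem_image.mpr ⟨b, Finset.mem_coe.mp hb, rfl⟩)
    exact hdis a b ha' hb' (hinjT hTa hTb hab)
  · rw [← coeff_pencil A f hsupp hdis φ a₀ ha₀A, ha₀e]
    exact mem_support_iff.mp he₀
  · intro b hbE hlt
    have hbA : ∀ j, b j ∈ A j := Fintype.mem_piFinset.mp hbE
    rw [← coeff_pencil A f hsupp hdis φ b hbA, ← notMem_support_iff]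
    intro hbsupp
    rw [lin_Xf_Yf_eq, lin_Xf_Yf_eq, ha₀e] at hlt
    have hne : ∑ j, b j ≠ e₀ := by
      intro h; rw [h] at hlt; exact lt_irrefl _ hlt
    exact lt_asymm hlt (hmax _ hbsupp hne)

/-- **The dictionary.**  On a dissociated frame the frame shadow of Theorem Q is exactly the set of words of the
box whose point is a vertex of the Newton polygon of some member `∑ i, C (φ i) * ∏ j, f i j` of the coefficient
pencil. [folklore] -/
theorem fshadow_eq_pencilVertexWords (A : Fin m → Finset (Fin 2 →₀ ℕ))
    (f : Fin k → Fin m → MvPolynomial (Fin 2) ℂ) (hsupp : ∀ i j, (f i j).support ⊆ A j)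
    (hdis : ∀ a b : Fin m → (Fin 2 →₀ ℕ), (∀ j, a j ∈ A j) → (∀ j, b j ∈ A j) → ∑ j, a j = ∑ j, b j → a = b) :
    fshadow A f = {a : Fin m → (Fin 2 →₀ ℕ) | a ∈ Fintype.piFinset A ∧ ∃ φ : Fin k → ℂ,
      (fun e : Fin 2 →₀ ℕ => fun i : Fin 2 => ((e i : ℕ) : ℝ)) (∑ j, a j) ∈
        Set.extremePoints ℝ (convexHull ℝ ((fun e : Fin 2 →₀ ℕ => fun i : Fin 2 => ((e i : ℕ) : ℝ)) ''
          ((∑ i, C (φ i) * ∏ j, f i j).support : Set (Fin 2 →₀ ℕ))))} := by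
  ext a
  constructor
  · intro ha
    exact ⟨cshadow_subset _ _ _ _ ha, exists_vertex_of_mem_fshadow A f hsupp hdis ha⟩
  · rintro ⟨haE, φ, hv⟩
    obtain ⟨a', ha', hpt⟩ := exists_mem_fshadow_of_vertex A f hsupp hdis φ hv
    have hsum : ∑ j, a' j = ∑ j, a j := by
      ext i
      have h := congr_fun hpt i
      dsimp only at h
      exact_mod_cast h
    have ha'A : ∀ j, a' j ∈ A j := Fintype.mem_piFinset.mp (cshadow_subset _ _ _ _ ha')
    have haA : ∀ j, a j ∈ A j := Fintype.mem_piFinset.mp haE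
    rw [← hdis a' a ha'A haA hsum]
    exact ha'


/-! ## The hypothesis-free kernel stub: reductions and the equivalence -/

/-- A frame whose sum map is not injective on the box has EMPTY frame shadow: two distinct words with the same point
have the same height in every direction, so no planar height is injective on the box. [folklore] -/
theorem fshadow_eq_empty_of_not_dissociated (A : Fin m → Finset (Fin 2 →₀ ℕ))
    (f : Fin k → Fin m → MvPolynomial (Fin 2) ℂ)
    (h : ¬ ∀ a b : Fin m → (Fin 2 →₀ ℕ), (∀ j, a j ∈ A j) → (∀ j, b j ∈ A j) → ∑ j, a j = ∑ j, b j → a = b) :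
    fshadow A f = ∅ := by
  push Not at h
  obtain ⟨a, b, ha, hb, hsum, hab⟩ := h
  refine Set.eq_empty_iff_forall_notMem.mpr fun e he => ?_
  obtain ⟨w, hinj, -⟩ := he
  refine hab (hinj (Finset.mem_coe.mpr (Fintype.mem_piFinset.mpr ha))
    (Finset.mem_coe.mpr (Fintype.mem_piFinset.mpr hb)) ?_)
  rw [lin_Xf_Yf_eq, lin_Xf_Yf_eq, hsum]

/-- Coefficients of the restriction `∑ l ∈ S, monomial l (coeff l p)` of a polynomial to the monomials of `S`
(the `restrictTo` of `…DissociatedUniformOfKLetterFrame`, inlined to keep this file off the route cone). [folklore] -/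
theorem coeff_sum_monomial_coeff (S : Finset (Fin 2 →₀ ℕ)) (p : MvPolynomial (Fin 2) ℂ) (l : Fin 2 →₀ ℕ) :
    (∑ l' ∈ S, monomial l' (p.coeff l')).coeff l = if l ∈ S then p.coeff l else 0 := by
  classical
  rw [coeff_sum]
  simp only [coeff_monomial]
  rw [Finset.sum_ite_eq' S l (fun x => p.coeff x)]

/-- The restriction to the monomials of `S` is supported on `S`. [folklore] -/
theorem support_sum_monomial_coeff (S : Finset (Fin 2 →₀ ℕ)) (p : MvPolynomial (Fin 2) ℂ) :
    (∑ l' ∈ S, monomial l' (p.coeff l')).support ⊆ S := by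
  intro l hl
  by_contra h
  rw [mem_support_iff, coeff_sum_monomial_coeff, if_neg h] at hl
  exact hl rfl

/-- The frame shadow only sees the coefficients on the alphabet: it is unchanged by restricting every `f i j` to
the monomials of `A j`. [folklore] -/
theorem fshadow_restrict (A : Fin m → Finset (Fin 2 →₀ ℕ)) (f : Fin k → Fin m → MvPolynomial (Fin 2) ℂ) :
    fshadow A f = fshadow A (fun i j => ∑ l ∈ A j, monomial l ((f i j).coeff l)) := by
  refine cshadow_congr_vec _ _ _ fun a ha => ?_
  funext i
  simp only [col]
  refine Finset.prod_congr rfl fun j _ => ?_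
  rw [coeff_sum_monomial_coeff, if_pos (Fintype.mem_piFinset.mp ha j)]

/-- **`SmallShadow` ⟺ pencil-uniform vertex count on small frames.**  The registered kernel stub
`stub_smallShadow` of line `greedy-basis-shadow` (its signature verbatim on the left) is equivalent to: on every
DISSOCIATED `k`-product frame with `n ≤ 4k²` coordinates, `≤ 4k² + 1` letters per coordinate and
`supp (f i j) ⊆ A j`, the words of the box whose point is a vertex of the Newton polygon of SOME pencil member
`∑ i, C (φ i) * ∏ j, f i j` (`φ : Fin k → ℂ`) number at most `(k + 2)^P`. [folklore] -/
theorem smallShadow_iff_pencilVertices :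
    (∃ P : ℕ, ∀ (k n : ℕ) (A : Fin n → Finset (Fin 2 →₀ ℕ)) (f : Fin k → Fin n → MvPolynomial (Fin 2) ℂ),
      n ≤ 4 * k ^ 2 → (∀ j, (A j).card ≤ 4 * k ^ 2 + 1) → (QuasiPoly.fshadow A f).ncard ≤ (k + 2) ^ P) ↔
    (∃ P : ℕ, ∀ (k n : ℕ) (A : Fin n → Finset (Fin 2 →₀ ℕ)) (f : Fin k → Fin n → MvPolynomial (Fin 2) ℂ),
      n ≤ 4 * k ^ 2 → (∀ j, (A j).card ≤ 4 * k ^ 2 + 1) → (∀ i j, (f i j).support ⊆ A j) →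
      (∀ a b : Fin n → (Fin 2 →₀ ℕ), (∀ j, a j ∈ A j) → (∀ j, b j ∈ A j) → ∑ j, a j = ∑ j, b j → a = b) →
      {a : Fin n → (Fin 2 →₀ ℕ) | a ∈ Fintype.piFinset A ∧ ∃ φ : Fin k → ℂ,
        (fun e : Fin 2 →₀ ℕ => fun i : Fin 2 => ((e i : ℕ) : ℝ)) (∑ j, a j) ∈
          Set.extremePoints ℝ (convexHull ℝ ((fun e : Fin 2 →₀ ℕ => fun i : Fin 2 => ((e i : ℕ) : ℝ)) ''
            ((∑ i, C (φ i) * ∏ j, f i j).support : Set (Fin 2 →₀ ℕ))))}.ncard ≤ (k + 2) ^ P) := by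
  constructor
  · rintro ⟨P, hP⟩
    refine ⟨P, fun k n A f hn hcard hsupp hdis => ?_⟩
    rw [← fshadow_eq_pencilVertexWords A f hsupp hdis]
    exact hP k n A f hn hcard
  · rintro ⟨P, hP⟩
    refine ⟨P, fun k n A f hn hcard => ?_⟩
    by_cases hdis : ∀ a b : Fin n → (Fin 2 →₀ ℕ), (∀ j, a j ∈ A j) → (∀ j, b j ∈ A j) →
        ∑ j, a j = ∑ j, b j → a = b
    · rw [fshadow_restrict A f, fshadow_eq_pencilVertexWords A _
        (fun i j => support_sum_monomial_coeff _ _) hdis]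
      exact hP k n A _ hn hcard (fun i j => support_sum_monomial_coeff _ _) hdis
    · rw [fshadow_eq_empty_of_not_dissociated A f hdis, Set.ncard_empty]
      exact Nat.zero_le _

end ShadowVertices

end Summit.ValiantsHypothesis.ValiantsHypothesis.Theorems.NewtonUnitEquationsDissociatedUniform
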